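import Literature.Analysis.FluidPDE.Tao2016AveragedNS.SplitCascadeAsymPast
import Literature.Analysis.FluidPDE.TaoCascadeRescaledBootstrap
import HarnessLib

/-!
# The split Prop. 6.5: the asymmetries of the higher shells `k ≥ 2` up to the present (`n₀`-smallness, uniform in `k`)

T. Tao, *Finite time blowup for an averaged three-dimensional Navier–Stokes equation*,
arXiv:1402.0290v3, §6.4 Lemma 6.7, (6.66); §6.5 (6.94) (`GoodAt.after`).
HONEST FRAMING: statements about the SPLIT cascade model system; nothing here proves the split
Prop. 6.5 and nothing here concerns the true Navier–Stokes equations.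

Profile reproduction at the next checkpoint (the `w_abs_le` clauses of `RescaledSplitConclusion` for
the shells `1+m`, `m ≥ 1`) needs the asymmetry triples of ALL shells `k ≥ 2` to be `n₀`-small on the
present window `[0, T]`. They vanish at `τ₀` ((6.50♯)); their energy inequality
(`SplitCascadeAsymEnergy.lean`) has rate `Λ_k(…)(√(2Ẽ_k), √(2Ẽ_{k+1}))` and source
`√3C₁(1+ε₀)^{2k-n₀/2}√Ẽ_k`, and the weights `Λ_k = (1+ε₀)^{5k/2}`, `(1+ε₀)^{2k}` are MORE than
compensated by the decay of `Ẽ_k` in `k` ((6.66) over the past: `Ẽ_k ≤ K⁻³⁰(1+ε₀)^{-10(k-j)+(1-j)/50}`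
on the `j`-th past interval; (6.94) on `[0,T]`: `Ẽ_k ≤ K⁻³⁰(1+ε₀)^{-10(k-1)}`). Hence UNIFORMLY IN
`k ≥ 2`: weighted levels `Λ_k√(2Ẽ_k), Λ_k√(2Ẽ_{k+1}) ≤ √2K⁻¹⁵(1+ε₀)^{(499/100)j}` (past) / `≤ √2K⁻¹⁵`
(present) and `(1+ε₀)^{2k}√Ẽ_k ≤ K⁻¹⁵(…)`; Lemma 6.7 sums the past, the present has length `≤ 100`;
the Euclidean Grönwall (`SplitCascadeAsymGronwall.lean`) gives
`(Σ_i Z̃_{i,k}(t)²)^{1/2} ≤ Z_hi := exp((c_ε + 6K)√2K⁻¹⁵(C₃G₂₄₈ + 100))·√3C₁(1+ε₀)^{-n₀/2}K⁻¹⁵(C₃G₂₄₈ + 100)`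
for `t ∈ [0, T]`, `k ≥ 2` (`asym_high_le`), `c_ε = ε + ε² + 2ε⁻² + ε⁻¹K¹⁰`.

## References

* T. Tao, arXiv:1402.0290v3, §6.4 Lemma 6.7, (6.66); §6.5 (6.94). [`Tao2016AveragedNS`]
* E. Hairer, S. P. Nørsett, G. Wanner, *Solving ODE I*, §I.10. [`HairerNorsettWanner1993`]
-/

noncomputable section

open Set MeasureTheory intervalIntegral

namespace Literature.Analysis.FluidPDE

namespace Tao2016AveragedNS

open TaoCascade
open Literature.Analysis.ODE

section AsymHigh

variable {γ ε₀ K ε C₁ C₂ C₃ : ℝ} {n₀ N : ℤ} {ηp : ℤ → ℝ} {βp : ℕ → ℝ} {τ : ℤ → ℝ}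
  {Y : Fin 4 → ℤ → ℝ → ℝ} {W : Fin 3 → ℤ → ℝ → ℝ} {F : ℤ → ℝ → ℝ}

/-- **(6.66) for a shell `k' ≥ k ≥ 2` over the past, weighted**: on the `j`-th past interval,
`(1+ε₀)^{5k} Ẽ_{k'} ≤ K⁻³⁰(1+ε₀)^{(499/50)j}` for `k' ∈ {k, k+1}`.
[cite: Tao2016AveragedNS, §6.4 Prop. 6.5 (6.66)] -/
theorem RescaledSplitHypotheses.weighted_energy_high_past_le
    (h : RescaledSplitHypotheses γ ε₀ K ε C₁ C₂ C₃ n₀ N ηp βp τ Y W F) (hε₀ : 0 < ε₀)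
    {k k' : ℤ} (hk : 2 ≤ k) (hk' : k ≤ k') (hk'2 : k' ≤ k + 1)
    {j : ℤ} (hj : n₀ - N < j) (hj0 : j ≤ 0) {t : ℝ} (ht : t ∈ Icc (τ (j - 1)) (τ j)) :
    (1 + ε₀) ^ ((5 : ℝ) * k) * F k' t ≤ (K ^ 30)⁻¹ * (1 + ε₀) ^ ((499 : ℝ) / 50 * j) := by
  have h0 : (0 : ℝ) < 1 + ε₀ := by linarith
  have h1 : (1 : ℝ) ≤ 1 + ε₀ := by linarith
  obtain ⟨m', hm'⟩ : ∃ m' : ℕ, (m' : ℤ) = k' - j := ⟨(k' - j).toNat, by omega⟩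
  have hb := h.en_after' j hj hj0 t ht m' (by omega)
  rw [show j + (m' : ℤ) = k' by omega] at hb
  have hexp : (5 : ℝ) * k + (-(10 : ℝ) * m' + (1 - j) / 50) =
      ((5 : ℝ) * k - 10 * k' + 1 / 50) + (499 : ℝ) / 50 * j := by
    have : (m' : ℝ) = (k' : ℝ) - (j : ℝ) := by exact_mod_cast hm'
    rw [this]; ring
  have hneg : (1 + ε₀) ^ ((5 : ℝ) * k - 10 * k' + 1 / 50) ≤ 1 := by
    apply Real.rpow_le_one_of_one_le_of_nonpos h1
    have hk2 : (2 : ℝ) ≤ k := by exact_mod_cast hk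
    have hkk : (k : ℝ) ≤ k' := by exact_mod_cast hk'
    linarith
  have hP : 0 < (1 + ε₀) ^ ((499 : ℝ) / 50 * j) := Real.rpow_pos_of_pos h0 _
  have hW : 0 ≤ (1 + ε₀) ^ ((5 : ℝ) * k) := Real.rpow_nonneg h0.le _
  have hprod : (1 + ε₀) ^ ((5 : ℝ) * k) * (1 + ε₀) ^ (-(10 : ℝ) * m' + (1 - j) / 50) =
      (1 + ε₀) ^ ((5 : ℝ) * k - 10 * k' + 1 / 50) * (1 + ε₀) ^ ((499 : ℝ) / 50 * j) := by
    rw [← Real.rpow_add h0, ← Real.rpow_add h0, hexp]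
  calc (1 + ε₀) ^ ((5 : ℝ) * k) * F k' t
      ≤ (1 + ε₀) ^ ((5 : ℝ) * k) * ((K ^ 30)⁻¹ * (1 + ε₀) ^ (-(10 : ℝ) * m' + (1 - j) / 50)) :=
        mul_le_mul_of_nonneg_left hb hW
    _ = (K ^ 30)⁻¹ * ((1 + ε₀) ^ ((5 : ℝ) * k) * (1 + ε₀) ^ (-(10 : ℝ) * m' + (1 - j) / 50)) := by
        ring
    _ = (K ^ 30)⁻¹ * ((1 + ε₀) ^ ((5 : ℝ) * k - 10 * k' + 1 / 50) * (1 + ε₀) ^ ((499 : ℝ) / 50 * j)) := by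
        rw [hprod]
    _ ≤ (K ^ 30)⁻¹ * (1 * (1 + ε₀) ^ ((499 : ℝ) / 50 * j)) := by
        apply mul_le_mul_of_nonneg_left _ (by positivity)
        exact mul_le_mul_of_nonneg_right hneg hP.le
    _ = _ := by ring

/-- **(6.94) for a shell `k' ≥ k ≥ 2` on the present window, weighted**: if `GoodAt` holds at `t`,
`(1+ε₀)^{5k} Ẽ_{k'}(t) ≤ K⁻³⁰` for `k' ∈ {k, k+1}`. [cite: Tao2016AveragedNS, §6.5 (6.94)] -/
theorem weighted_energy_high_present_le (hε₀ : 0 < ε₀) {t : ℝ} (hg : GoodAt ε₀ K Y F t)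
    {k k' : ℤ} (hk : 2 ≤ k) (hk' : k ≤ k') (hk'2 : k' ≤ k + 1) :
    (1 + ε₀) ^ ((5 : ℝ) * k) * F k' t ≤ (K ^ 30)⁻¹ := by
  have h0 : (0 : ℝ) < 1 + ε₀ := by linarith
  have h1 : (1 : ℝ) ≤ 1 + ε₀ := by linarith
  obtain ⟨m', hm'⟩ : ∃ m' : ℕ, (m' : ℤ) = k' - 1 := ⟨(k' - 1).toNat, by omega⟩
  have ha := hg.after m' (by omega)
  rw [show (1 : ℤ) + (m' : ℤ) = k' by omega] at ha
  have hexp : (5 : ℝ) * k + -(10 : ℝ) * m' = (5 : ℝ) * k - 10 * k' + 10 := by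
    have : (m' : ℝ) = (k' : ℝ) - 1 := by exact_mod_cast hm'
    rw [this]; ring
  have hneg : (1 + ε₀) ^ ((5 : ℝ) * k - 10 * k' + 10) ≤ 1 := by
    apply Real.rpow_le_one_of_one_le_of_nonpos h1
    have hk2 : (2 : ℝ) ≤ k := by exact_mod_cast hk
    have hkk : (k : ℝ) ≤ k' := by exact_mod_cast hk'
    linarith
  have hW : 0 ≤ (1 + ε₀) ^ ((5 : ℝ) * k) := Real.rpow_nonneg h0.le _
  have hprod : (1 + ε₀) ^ ((5 : ℝ) * k) * (1 + ε₀) ^ (-(10 : ℝ) * m') =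
      (1 + ε₀) ^ ((5 : ℝ) * k - 10 * k' + 10) := by
    rw [← Real.rpow_add h0, hexp]
  calc (1 + ε₀) ^ ((5 : ℝ) * k) * F k' t
      ≤ (1 + ε₀) ^ ((5 : ℝ) * k) * ((K ^ 30)⁻¹ * (1 + ε₀) ^ (-(10 : ℝ) * m')) :=
        mul_le_mul_of_nonneg_left ha hW
    _ = (K ^ 30)⁻¹ * ((1 + ε₀) ^ ((5 : ℝ) * k) * (1 + ε₀) ^ (-(10 : ℝ) * m')) := by ring
    _ = (K ^ 30)⁻¹ * (1 + ε₀) ^ ((5 : ℝ) * k - 10 * k' + 10) := by rw [hprod]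
    _ ≤ (K ^ 30)⁻¹ * 1 := mul_le_mul_of_nonneg_left hneg (by positivity)
    _ = _ := mul_one _

/-- `Λ_k √(2x) = √(2 Λ_k² x)` and `(1+ε₀)^{2k}√x ≤ √((1+ε₀)^{5k} x)` bookkeeping: for `a ≥ 0`,
`a·√y = √(a²y)`. [cite: Tao2016AveragedNS, §6.4] -/
theorem mul_sqrt_eq_sqrt_sq_mul {a y : ℝ} (ha : 0 ≤ a) : a * Real.sqrt y = Real.sqrt (a ^ 2 * y) := by
  rw [Real.sqrt_mul (sq_nonneg a), Real.sqrt_sq ha]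

/-- **The asymmetries of the shells `k ≥ 2` are `n₀`-small up to the present, uniformly in `k`.**
With `GoodAt` on `[0, T]`, `T ≤ 100`: for every `k ≥ 2` and `t ∈ [0, T]`,
`(Σ_i Z̃_{i,k}(t)²)^{1/2} ≤ exp((c_ε + 6K)√2K⁻¹⁵(C₃G₂₄₈ + 100)) · √3C₁(1+ε₀)^{-n₀/2}K⁻¹⁵(C₃G₂₄₈ + 100)`,
`c_ε = ε + ε² + 2ε⁻² + ε⁻¹K¹⁰`, `G₂₄₈ = geomConst ε₀ (248/100)`.
[cite: Tao2016AveragedNS, §6.4 Lemma 6.7, (6.66); §6.5 (6.94)] -/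
theorem RescaledSplitHypotheses.asym_high_le
    (h : RescaledSplitHypotheses γ ε₀ K ε C₁ C₂ C₃ n₀ N ηp βp τ Y W F) (hε₀ : 0 < ε₀) (hε₀1 : ε₀ < 1)
    (hK : 1 ≤ K) (hε : 0 < ε) (hC₁ : 0 ≤ C₁) (hC₃ : 0 ≤ C₃) (hN : n₀ ≤ N) {T : ℝ} (hT : T ≤ 100)
    (hgood : ∀ t ∈ Icc 0 T, GoodAt ε₀ K Y F t) {k : ℤ} (hk : 2 ≤ k) {t : ℝ} (ht : t ∈ Icc 0 T) :
    Real.sqrt (∑ i, W i k t ^ 2) ≤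
      Real.exp ((ε + ε ^ 2 + 2 * (ε ^ 2)⁻¹ + ε⁻¹ * K ^ 10 + 6 * K) * Real.sqrt 2 * (K ^ 15)⁻¹ *
          (C₃ * geomConst ε₀ ((248 : ℝ) / 100) + 100)) *
        (Real.sqrt 3 * C₁ * (1 + ε₀) ^ (-(n₀ : ℝ) / 2) * (K ^ 15)⁻¹ *
          (C₃ * geomConst ε₀ ((248 : ℝ) / 100) + 100)) := by
  have h0 : (0 : ℝ) < 1 + ε₀ := by linarith
  have hK0 : 0 < K := by linarith
  set τ₀ := τ (n₀ - N) with hτ₀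
  have hτ00 : τ₀ ≤ 0 := h.tau_init_le hN
  have hτt : τ₀ ≤ t := hτ00.trans ht.1
  set δ : ℝ := (1 + ε₀) ^ (-(n₀ : ℝ) / 2) with hδ
  have hδ0 : 0 < δ := Real.rpow_pos_of_pos h0 _
  set Λk : ℝ := (1 + ε₀) ^ ((5 : ℝ) * k / 2) with hΛk
  have hΛk0 : 0 ≤ Λk := (Real.rpow_pos_of_pos h0 _).le
  have hΛk2 : Λk ^ 2 = (1 + ε₀) ^ ((5 : ℝ) * k) := by
    rw [hΛk, ← Real.rpow_natCast, ← Real.rpow_mul h0.le]; congr 1; push_cast; ring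
  set Ek : ℝ := (1 + ε₀) ^ ((2 : ℝ) * k) with hEk
  have hEk0 : 0 ≤ Ek := (Real.rpow_pos_of_pos h0 _).le
  have hEk2 : Ek ^ 2 ≤ (1 + ε₀) ^ ((5 : ℝ) * k) := by
    rw [hEk, ← Real.rpow_natCast, ← Real.rpow_mul h0.le]
    apply Real.rpow_le_rpow_of_exponent_le (by linarith)
    have hk2 : (2 : ℝ) ≤ k := by exact_mod_cast hk
    push_cast; nlinarith
  set G : ℝ := C₃ * geomConst ε₀ ((248 : ℝ) / 100) with hG
  have hG0 : 0 ≤ G := by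
    have := geomConst_pos hε₀ (s := (248 : ℝ) / 100) (by norm_num); positivity
  set cε : ℝ := ε + ε ^ 2 + 2 * (ε ^ 2)⁻¹ + ε⁻¹ * K ^ 10 with hcε
  have hcε0 : 0 ≤ cε := by positivity
  have hq6 : (1 + ε₀) ^ ((5 : ℝ) / 2) ≤ 6 := rpow_five_halves_le_six h0.le (by linarith)
  -- majorants on `[τ₀, T]`
  set β : ℝ → ℝ := fun s => Λk * (cε * Real.sqrt (2 * F k s) + 6 * K * Real.sqrt (2 * F (k + 1) s))
    with hβ
  set R : ℝ → ℝ := fun s => Real.sqrt 3 * C₁ * δ * (Ek * Real.sqrt (F k s)) with hR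
  have hβc : ContinuousOn β (Icc τ₀ T) :=
    continuousOn_const.mul ((continuousOn_const.mul ((continuousOn_const.mul
      (h.continuousOn_E k le_rfl)).sqrt)).add
      (continuousOn_const.mul ((continuousOn_const.mul (h.continuousOn_E (k + 1) le_rfl)).sqrt)))
  have hRc : ContinuousOn R (Icc τ₀ T) :=
    continuousOn_const.mul (continuousOn_const.mul (h.continuousOn_E k le_rfl).sqrt)
  have hβ0 : ∀ s ∈ Icc τ₀ T, 0 ≤ β s := fun s _ => by simp only [hβ]; positivity
  have hR0 : ∀ s ∈ Icc τ₀ T, 0 ≤ R s := fun s _ => by simp only [hR]; positivity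
  -- domination of the rate and of the source
  have hrate : ∀ s ∈ Ico τ₀ T, (1 + ε₀) ^ ((5 : ℝ) * k / 2) * (ε * |Y 1 k s| +
      ε ^ 2 * Real.exp (-K ^ 10) * |Y 2 k s| + (ε ^ 2)⁻¹ * (|Y 0 k s| + |Y 3 k s|) +
      ε⁻¹ * K ^ 10 * |Y 1 k s| + (1 + ε₀) ^ ((5 : ℝ) / 2) * K * |Y 0 (k + 1) s|) ≤ β s := by
    intro s hs
    have hs1 : τ (n₀ - N) ≤ s := hs.1
    have hY : ∀ j : Fin 4, |Y j k s| ≤ Real.sqrt (2 * F k s) := fun j => h.abs_le_sqrt_energy j k hs1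
    have hY2 : |Y 0 (k + 1) s| ≤ Real.sqrt (2 * F (k + 1) s) := h.abs_le_sqrt_energy 0 (k + 1) hs1
    rw [← hΛk]
    set X := Real.sqrt (2 * F k s) with hX
    set X2 := Real.sqrt (2 * F (k + 1) s) with hX2
    have hE1 : Real.exp (-K ^ 10) ≤ 1 := Real.exp_le_one_iff.mpr (by
      have : 0 ≤ K ^ 10 := by positivity
      linarith)
    have hin : ε * |Y 1 k s| + ε ^ 2 * Real.exp (-K ^ 10) * |Y 2 k s| +
        (ε ^ 2)⁻¹ * (|Y 0 k s| + |Y 3 k s|) + ε⁻¹ * K ^ 10 * |Y 1 k s| +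
        (1 + ε₀) ^ ((5 : ℝ) / 2) * K * |Y 0 (k + 1) s| ≤ cε * X + 6 * K * X2 := by
      have a1 : ε * |Y 1 k s| ≤ ε * X := mul_le_mul_of_nonneg_left (hY 1) hε.le
      have a2 : ε ^ 2 * Real.exp (-K ^ 10) * |Y 2 k s| ≤ ε ^ 2 * 1 * X :=
        mul_le_mul (mul_le_mul_of_nonneg_left hE1 (sq_nonneg _)) (hY 2) (abs_nonneg _) (by positivity)
      have a3 : (ε ^ 2)⁻¹ * (|Y 0 k s| + |Y 3 k s|) ≤ (ε ^ 2)⁻¹ * (X + X) :=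
        mul_le_mul_of_nonneg_left (add_le_add (hY 0) (hY 3)) (by positivity)
      have a4 : ε⁻¹ * K ^ 10 * |Y 1 k s| ≤ ε⁻¹ * K ^ 10 * X :=
        mul_le_mul_of_nonneg_left (hY 1) (by positivity)
      have a5 : (1 + ε₀) ^ ((5 : ℝ) / 2) * K * |Y 0 (k + 1) s| ≤ 6 * K * X2 :=
        mul_le_mul (mul_le_mul_of_nonneg_right hq6 hK0.le) hY2 (abs_nonneg _) (by positivity)
      have e : cε * X = ε * X + ε ^ 2 * 1 * X + (ε ^ 2)⁻¹ * (X + X) + ε⁻¹ * K ^ 10 * X := by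
        simp only [hcε]; ring
      linarith
    exact mul_le_mul_of_nonneg_left hin hΛk0
  have hsrc : ∀ s ∈ Ico τ₀ T,
      Real.sqrt 3 * (C₁ * (1 + ε₀) ^ ((2 : ℝ) * k - n₀ / 2) * Real.sqrt (F k s)) ≤ R s := by
    intro s _
    have hsplit : (1 + ε₀) ^ ((2 : ℝ) * k - n₀ / 2) = Ek * δ := by
      rw [hEk, hδ, ← Real.rpow_add h0]; congr 1; ring
    rw [hsplit]; simp only [hR]; apply le_of_eq; ring
  -- Grönwall on `[τ₀, T]`
  have hmain := h.sqrt_asym_sq_le (by linarith) hε hK0.le k (t₁ := τ₀) (t₂ := T) le_rfl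
    hβc hβ0 hrate hRc hR0 hsrc ⟨hτt, ht.2⟩
  have hinit : Real.sqrt (∑ i, W i k τ₀ ^ 2) = 0 := by
    have : ∑ i, W i k τ₀ ^ 2 = 0 := Finset.sum_eq_zero fun i _ => by
      rw [hτ₀, h.init_W i k (by omega)]; ring
    rw [this, Real.sqrt_zero]
  rw [hinit, zero_add] at hmain
  -- uniform levels: past pieces
  have hs2 : ∀ x : ℝ, Real.sqrt (2 * x) = Real.sqrt 2 * Real.sqrt x := fun x =>
    Real.sqrt_mul (by norm_num) x
  have hlev_past : ∀ j, n₀ - N < j → j ≤ 0 → ∀ s ∈ Icc (τ (j - 1)) (τ j), ∀ k' : ℤ, k ≤ k' → k' ≤ k + 1 →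
      Λk * Real.sqrt (F k' s) ≤ (K ^ 15)⁻¹ * (1 + ε₀) ^ (((248 : ℝ) / 100 + (251 : ℝ) / 100) * j) := by
    intro j hj hj0 s hs k' hk1 hk2
    have hw := h.weighted_energy_high_past_le hε₀ hk hk1 hk2 hj hj0 hs
    rw [mul_sqrt_eq_sqrt_sq_mul hΛk0, hΛk2, ← sqrt_energy_level_eq hε₀ hK0 j]
    exact Real.sqrt_le_sqrt hw
  have hlevE_past : ∀ j, n₀ - N < j → j ≤ 0 → ∀ s ∈ Icc (τ (j - 1)) (τ j),
      Ek * Real.sqrt (F k s) ≤ (K ^ 15)⁻¹ * (1 + ε₀) ^ (((248 : ℝ) / 100 + (251 : ℝ) / 100) * j) := by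
    intro j hj hj0 s hs
    have hw := h.weighted_energy_high_past_le hε₀ hk le_rfl (by omega) hj hj0 hs
    have hF0 : 0 ≤ F k s := h.nonneg_F k s ((h.tau_init_le_tau (by omega) (by omega)).trans hs.1)
    rw [mul_sqrt_eq_sqrt_sq_mul hEk0, ← sqrt_energy_level_eq hε₀ hK0 j]
    exact Real.sqrt_le_sqrt ((mul_le_mul_of_nonneg_right hEk2 hF0).trans hw)
  -- uniform levels: present
  have hlev_pres : ∀ s ∈ Icc 0 T, ∀ k' : ℤ, k ≤ k' → k' ≤ k + 1 →
      Λk * Real.sqrt (F k' s) ≤ (K ^ 15)⁻¹ := by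
    intro s hs k' hk1 hk2
    have hw := weighted_energy_high_present_le hε₀ (hgood s hs) hk hk1 hk2
    rw [mul_sqrt_eq_sqrt_sq_mul hΛk0, hΛk2]
    calc Real.sqrt ((1 + ε₀) ^ ((5 : ℝ) * k) * F k' s) ≤ Real.sqrt ((K ^ 30)⁻¹) := Real.sqrt_le_sqrt hw
      _ = (K ^ 15)⁻¹ := by
          rw [show (K ^ 30)⁻¹ = ((K ^ 15)⁻¹) ^ 2 by ring, Real.sqrt_sq (by positivity)]
  have hlevE_pres : ∀ s ∈ Icc 0 T, Ek * Real.sqrt (F k s) ≤ (K ^ 15)⁻¹ := by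
    intro s hs
    have hw := weighted_energy_high_present_le hε₀ (hgood s hs) hk le_rfl (by omega)
    have hF0 : 0 ≤ F k s := h.nonneg_F k s (hτ00.trans hs.1)
    rw [mul_sqrt_eq_sqrt_sq_mul hEk0]
    calc Real.sqrt (Ek ^ 2 * F k s) ≤ Real.sqrt ((K ^ 30)⁻¹) :=
          Real.sqrt_le_sqrt ((mul_le_mul_of_nonneg_right hEk2 hF0).trans hw)
      _ = (K ^ 15)⁻¹ := by
          rw [show (K ^ 30)⁻¹ = ((K ^ 15)⁻¹) ^ 2 by ring, Real.sqrt_sq (by positivity)]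
  -- integrability helpers
  have hβi : ∀ {x y : ℝ}, τ₀ ≤ x → x ≤ y → y ≤ T → IntervalIntegrable β volume x y :=
    fun hx hxy hy => (hβc.mono (Icc_subset_Icc hx hy)).intervalIntegrable_of_Icc hxy
  have hRi : ∀ {x y : ℝ}, τ₀ ≤ x → x ≤ y → y ≤ T → IntervalIntegrable R volume x y :=
    fun hx hxy hy => (hRc.mono (Icc_subset_Icc hx hy)).intervalIntegrable_of_Icc hxy
  -- `∫_{τ₀}^t β ≤ (cε + 6K) √2 K⁻¹⁵ (G + 100)`
  have hβint : ∫ s in τ₀..t, β s ≤ (cε + 6 * K) * Real.sqrt 2 * (K ^ 15)⁻¹ * (G + 100) := by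
    rw [← integral_add_adjacent_intervals (hβi le_rfl hτ00 (ht.1.trans ht.2)) (hβi hτ00 ht.1 ht.2)]
    -- past
    have hbound : ∀ j, n₀ - N < j → j ≤ 0 → ∀ s ∈ Icc (τ (j - 1)) (τ j),
        β s ≤ (cε + 6 * K) * Real.sqrt 2 * (K ^ 15)⁻¹ *
          (1 + ε₀) ^ (((248 : ℝ) / 100 + (251 : ℝ) / 100) * j) := by
      intro j hj hj0 s hs
      have l1 := hlev_past j hj hj0 s hs k le_rfl (by omega)
      have l2 := hlev_past j hj hj0 s hs (k + 1) (by omega) le_rfl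
      simp only [hβ]
      rw [hs2, hs2]
      have e : Λk * (cε * (Real.sqrt 2 * Real.sqrt (F k s)) + 6 * K * (Real.sqrt 2 * Real.sqrt (F (k + 1) s))) =
          Real.sqrt 2 * (cε * (Λk * Real.sqrt (F k s)) + 6 * K * (Λk * Real.sqrt (F (k + 1) s))) := by ring
      rw [e]
      have hs20 : 0 ≤ Real.sqrt 2 := Real.sqrt_nonneg _
      have a1 := mul_le_mul_of_nonneg_left l1 hcε0
      have a2 := mul_le_mul_of_nonneg_left l2 (by positivity : (0 : ℝ) ≤ 6 * K)
      have := mul_le_mul_of_nonneg_left (add_le_add a1 a2) hs20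
      calc _ ≤ _ := this
        _ = _ := by ring
    have hcont0 : ContinuousOn β (Icc (τ (n₀ - N)) 0) := hβc.mono (Icc_subset_Icc le_rfl (ht.1.trans ht.2))
    have hsum := h.integral_past_le hε₀ hC₃ hcont0 (D := (cε + 6 * K) * Real.sqrt 2 * (K ^ 15)⁻¹)
      (s := (248 : ℝ) / 100) (by positivity) (by norm_num) hbound (k := 0) (by omega) le_rfl
    rw [h.tau_zero] at hsum
    simp only [Int.cast_zero, mul_zero, Real.rpow_zero, mul_one] at hsum
    -- present
    have hpres : ∫ s in (0 : ℝ)..t, β s ≤ (cε + 6 * K) * Real.sqrt 2 * (K ^ 15)⁻¹ * 100 := by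
      have hm : ∫ s in (0 : ℝ)..t, β s ≤ ∫ s in (0 : ℝ)..t, (cε + 6 * K) * Real.sqrt 2 * (K ^ 15)⁻¹ := by
        apply integral_mono_on ht.1 (hβi hτ00 ht.1 ht.2) intervalIntegrable_const
        intro s hs
        have hs' : s ∈ Icc 0 T := ⟨hs.1, hs.2.trans ht.2⟩
        have l1 := hlev_pres s hs' k le_rfl (by omega)
        have l2 := hlev_pres s hs' (k + 1) (by omega) le_rfl
        simp only [hβ]
        rw [hs2, hs2]
        have e : Λk * (cε * (Real.sqrt 2 * Real.sqrt (F k s)) + 6 * K * (Real.sqrt 2 * Real.sqrt (F (k + 1) s))) =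
            Real.sqrt 2 * (cε * (Λk * Real.sqrt (F k s)) + 6 * K * (Λk * Real.sqrt (F (k + 1) s))) := by ring
        rw [e]
        have hs20 : 0 ≤ Real.sqrt 2 := Real.sqrt_nonneg _
        have a1 := mul_le_mul_of_nonneg_left l1 hcε0
        have a2 := mul_le_mul_of_nonneg_left l2 (by positivity : (0 : ℝ) ≤ 6 * K)
        have := mul_le_mul_of_nonneg_left (add_le_add a1 a2) hs20
        calc _ ≤ _ := this
          _ = _ := by ring
      rw [intervalIntegral.integral_const, smul_eq_mul] at hm
      have ht100 : t ≤ 100 := ht.2.trans hT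
      have hc0 : 0 ≤ (cε + 6 * K) * Real.sqrt 2 * (K ^ 15)⁻¹ := by positivity
      calc ∫ s in (0 : ℝ)..t, β s ≤ (t - 0) * ((cε + 6 * K) * Real.sqrt 2 * (K ^ 15)⁻¹) := hm
        _ ≤ 100 * ((cε + 6 * K) * Real.sqrt 2 * (K ^ 15)⁻¹) := by
            rw [sub_zero]; exact mul_le_mul_of_nonneg_right ht100 hc0
        _ = _ := by ring
    have hτz : τ₀ = τ (n₀ - N) := rfl
    calc (∫ s in τ₀..(0 : ℝ), β s) + ∫ s in (0 : ℝ)..t, β s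
        ≤ (cε + 6 * K) * Real.sqrt 2 * (K ^ 15)⁻¹ * C₃ * geomConst ε₀ ((248 : ℝ) / 100) +
          (cε + 6 * K) * Real.sqrt 2 * (K ^ 15)⁻¹ * 100 := add_le_add hsum hpres
      _ = _ := by simp only [hG]; ring
  -- `∫_{τ₀}^t R ≤ √3 C₁ δ K⁻¹⁵ (G + 100)`
  have hRint : ∫ s in τ₀..t, R s ≤ Real.sqrt 3 * C₁ * δ * (K ^ 15)⁻¹ * (G + 100) := by
    rw [← integral_add_adjacent_intervals (hRi le_rfl hτ00 (ht.1.trans ht.2)) (hRi hτ00 ht.1 ht.2)]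
    have hbound : ∀ j, n₀ - N < j → j ≤ 0 → ∀ s ∈ Icc (τ (j - 1)) (τ j),
        R s ≤ Real.sqrt 3 * C₁ * δ * (K ^ 15)⁻¹ *
          (1 + ε₀) ^ (((248 : ℝ) / 100 + (251 : ℝ) / 100) * j) := by
      intro j hj hj0 s hs
      have l1 := hlevE_past j hj hj0 s hs
      simp only [hR]
      have : 0 ≤ Real.sqrt 3 * C₁ * δ := by positivity
      calc Real.sqrt 3 * C₁ * δ * (Ek * Real.sqrt (F k s))
          ≤ Real.sqrt 3 * C₁ * δ * ((K ^ 15)⁻¹ * (1 + ε₀) ^ (((248 : ℝ) / 100 + (251 : ℝ) / 100) * j)) :=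
            mul_le_mul_of_nonneg_left l1 this
        _ = _ := by ring
    have hcont0 : ContinuousOn R (Icc (τ (n₀ - N)) 0) := hRc.mono (Icc_subset_Icc le_rfl (ht.1.trans ht.2))
    have hsum := h.integral_past_le hε₀ hC₃ hcont0 (D := Real.sqrt 3 * C₁ * δ * (K ^ 15)⁻¹)
      (s := (248 : ℝ) / 100) (by positivity) (by norm_num) hbound (k := 0) (by omega) le_rfl
    rw [h.tau_zero] at hsum
    simp only [Int.cast_zero, mul_zero, Real.rpow_zero, mul_one] at hsum
    have hpres : ∫ s in (0 : ℝ)..t, R s ≤ Real.sqrt 3 * C₁ * δ * (K ^ 15)⁻¹ * 100 := by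
      have hm : ∫ s in (0 : ℝ)..t, R s ≤ ∫ s in (0 : ℝ)..t, Real.sqrt 3 * C₁ * δ * (K ^ 15)⁻¹ := by
        apply integral_mono_on ht.1 (hRi hτ00 ht.1 ht.2) intervalIntegrable_const
        intro s hs
        have l1 := hlevE_pres s ⟨hs.1, hs.2.trans ht.2⟩
        simp only [hR]
        have : 0 ≤ Real.sqrt 3 * C₁ * δ := by positivity
        calc Real.sqrt 3 * C₁ * δ * (Ek * Real.sqrt (F k s)) ≤ Real.sqrt 3 * C₁ * δ * (K ^ 15)⁻¹ :=
              mul_le_mul_of_nonneg_left l1 this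
          _ = _ := by ring
      rw [intervalIntegral.integral_const, smul_eq_mul] at hm
      have ht100 : t ≤ 100 := ht.2.trans hT
      have hc0 : 0 ≤ Real.sqrt 3 * C₁ * δ * (K ^ 15)⁻¹ := by positivity
      calc ∫ s in (0 : ℝ)..t, R s ≤ (t - 0) * (Real.sqrt 3 * C₁ * δ * (K ^ 15)⁻¹) := hm
        _ ≤ 100 * (Real.sqrt 3 * C₁ * δ * (K ^ 15)⁻¹) := by
            rw [sub_zero]; exact mul_le_mul_of_nonneg_right ht100 hc0
        _ = _ := by ring
    calc (∫ s in τ₀..(0 : ℝ), R s) + ∫ s in (0 : ℝ)..t, R s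
        ≤ Real.sqrt 3 * C₁ * δ * (K ^ 15)⁻¹ * C₃ * geomConst ε₀ ((248 : ℝ) / 100) +
          Real.sqrt 3 * C₁ * δ * (K ^ 15)⁻¹ * 100 := add_le_add hsum hpres
      _ = _ := by simp only [hG]; ring
  -- assemble
  have hE : Real.exp (∫ s in τ₀..t, β s) ≤
      Real.exp ((cε + 6 * K) * Real.sqrt 2 * (K ^ 15)⁻¹ * (G + 100)) := Real.exp_le_exp.2 hβint
  have hRint0 : 0 ≤ ∫ s in τ₀..t, R s :=
    integral_nonneg hτt fun s hs => hR0 s ⟨hs.1, hs.2.trans ht.2⟩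
  calc Real.sqrt (∑ i, W i k t ^ 2) ≤ Real.exp (∫ s in τ₀..t, β s) * ∫ s in τ₀..t, R s := hmain
    _ ≤ Real.exp ((cε + 6 * K) * Real.sqrt 2 * (K ^ 15)⁻¹ * (G + 100)) *
        (Real.sqrt 3 * C₁ * δ * (K ^ 15)⁻¹ * (G + 100)) := mul_le_mul hE hRint hRint0 (Real.exp_pos _).le
    _ = _ := by simp only [hcε, hG, hδ]

end AsymHigh

end Tao2016AveragedNS

end Literature.Analysis.FluidPDE
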